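import Mathlib.RingTheory.Flat.FaithfullyFlat.Algebra
import Mathlib.RingTheory.FinitePresentation
import Mathlib.RingTheory.TensorProduct.Quotient
import Mathlib.LinearAlgebra.TensorProduct.RightExactness
import HarnessLib

/-!
# Descent of finite presentation along faithfully flat maps (Stacks 02KK) — the abstract core

## Main results

* `finitePresentation_of_faithfullyFlat_surjective_tmul` (**the core of Stacks 02KK / 034Y**): let
  `Λ → A₁ → R` with `A₁` of finite presentation over `Λ`, and let `B₁` be a faithfully flat
  `A₁`-algebra of finite presentation such that `B₁ ⊗_{A₁} R` is of finite presentation over `Λ`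
  and `B₁ → B₁ ⊗_{A₁} R`, `b ↦ b ⊗ 1`, is surjective. Then `R` is of finite presentation over `Λ`.
  (`A₁ → R` is surjective since its cokernel dies after the faithfully flat base change; its
  kernel `𝔞` satisfies `𝔞B₁ = Ker(B₁ → B₁ ⊗ R)`, finitely generated; a finitely generated `𝔞′ ⊆ 𝔞`
  with `𝔞′B₁ = 𝔞B₁` equals `𝔞` by faithful flatness.)

## References

* [The Stacks Project, Tags 02KK, 034Y][StacksProject]
-/

open TensorProduct

namespace Literature.RingTheory.Flat

/-- A finitely generated extended ideal is the extension of a finitely generated subideal.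
[folklore] -/
theorem _root_.Ideal.exists_fg_le_map_eq {A B : Type*} [CommRing A] [CommRing B] [Algebra A B]
    (𝔞 : Ideal A) (h : (𝔞.map (algebraMap A B)).FG) :
    ∃ 𝔞' : Ideal A, 𝔞'.FG ∧ 𝔞' ≤ 𝔞 ∧ 𝔞'.map (algebraMap A B) = 𝔞.map (algebraMap A B) := by
  classical
  obtain ⟨s, hs⟩ := h
  have hgen : ∀ g : ↥s, ∃ t : Finset A, (↑t ⊆ (𝔞 : Set A)) ∧
      (g : B) ∈ Ideal.span (algebraMap A B '' ↑t) := by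
    intro g
    have hg : (g : B) ∈ Submodule.span B (algebraMap A B '' (𝔞 : Set A)) := by
      have : (g : B) ∈ 𝔞.map (algebraMap A B) := hs ▸ Submodule.subset_span g.2
      exact this
    obtain ⟨T, hT, hgT⟩ := Submodule.mem_span_finite_of_mem_span hg
    have hpre : ∀ b : ↥T, ∃ a : A, a ∈ 𝔞 ∧ algebraMap A B a = b := fun b =>
      (Set.mem_image _ _ _).mp (hT b.2)
    choose a ha hab using hpre
    refine ⟨Finset.univ.image a, ?_, ?_⟩
    · intro x hx
      obtain ⟨b, -, rfl⟩ := Finset.mem_image.mp (Finset.mem_coe.mp hx)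
      exact ha b
    · refine Submodule.span_mono ?_ hgT
      intro x hx
      exact ⟨a ⟨x, hx⟩, Finset.mem_coe.mpr (Finset.mem_image_of_mem a (Finset.mem_univ _)), hab ⟨x, hx⟩⟩
  choose t ht hgt using hgen
  refine ⟨Ideal.span ↑(Finset.univ.biUnion t), ⟨_, rfl⟩, ?_, ?_⟩
  · rw [Ideal.span_le]
    intro x hx
    obtain ⟨g, -, hxg⟩ := Finset.mem_biUnion.mp (Finset.mem_coe.mp hx)
    exact ht g hxg
  · apply le_antisymm
    · exact Ideal.map_mono (Ideal.span_le.mpr fun x hx => by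
        obtain ⟨g, -, hxg⟩ := Finset.mem_biUnion.mp (Finset.mem_coe.mp hx)
        exact ht g hxg)
    · rw [← hs, Ideal.span_le]
      intro g hg
      have h1 := hgt ⟨g, hg⟩
      have hle : Ideal.span (algebraMap A B '' ↑(t ⟨g, hg⟩)) ≤
          (Ideal.span (↑(Finset.univ.biUnion t) : Set A)).map (algebraMap A B) := by
        rw [Ideal.span_le]
        rintro _ ⟨x, hx, rfl⟩
        exact Ideal.mem_map_of_mem _ (Ideal.subset_span (Finset.mem_coe.mpr
          (Finset.mem_biUnion.mpr ⟨⟨g, hg⟩, Finset.mem_univ _, hx⟩)))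
      exact hle h1

/-- **Descent of finite presentation along a faithfully flat map of finite presentation, abstract
core** (The Stacks Project, Tag 02KK with Tag 034Y): `Λ → A₁ → R`, `A₁` of finite presentation
over `Λ`, `B₁` faithfully flat of finite presentation over `A₁`, `B₁ ⊗_{A₁} R` of finite
presentation over `Λ` and `B₁ → B₁ ⊗_{A₁} R` surjective; then `R` is of finite presentation over
`Λ`. [cite: StacksProject, Tag 02KK] -/
theorem finitePresentation_of_faithfullyFlat_surjective_tmul {Λ A₁ R B₁ : Type*} [CommRing Λ]
    [CommRing A₁] [CommRing R] [CommRing B₁] [Algebra Λ A₁] [Algebra Λ R] [Algebra A₁ R]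
    [IsScalarTower Λ A₁ R] [Algebra A₁ B₁] [Algebra Λ B₁] [IsScalarTower Λ A₁ B₁]
    [Algebra.FinitePresentation Λ A₁] [Module.FaithfullyFlat A₁ B₁]
    [Algebra.FinitePresentation A₁ B₁] [Algebra.FinitePresentation Λ (B₁ ⊗[A₁] R)]
    (hsurj : ∀ z : B₁ ⊗[A₁] R, ∃ b : B₁, b ⊗ₜ[A₁] (1 : R) = z) :
    Algebra.FinitePresentation Λ R := by
  classical
  -- Step 1: `A₁ → R` is surjective
  let θ : A₁ →ₗ[A₁] R := Algebra.linearMap A₁ R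
  have hθsurj : Function.Surjective (algebraMap A₁ R) := by
    let C := R ⧸ LinearMap.range θ
    haveI : Subsingleton (B₁ ⊗[A₁] C) := by
      have hex : Function.Exact (θ.lTensor B₁) ((LinearMap.range θ).mkQ.lTensor B₁) :=
        lTensor_exact B₁ (LinearMap.exact_map_mkQ_range θ) (Submodule.mkQ_surjective _)
      refine subsingleton_of_forall_eq 0 fun z => ?_
      obtain ⟨w, rfl⟩ := LinearMap.lTensor_surjective B₁ (Submodule.mkQ_surjective _) z
      obtain ⟨b, rfl⟩ := hsurj w
      exact (hex (b ⊗ₜ[A₁] (1 : R))).mpr ⟨b ⊗ₜ[A₁] (1 : A₁), by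
        rw [LinearMap.lTensor_tmul, Algebra.linearMap_apply, map_one]⟩
    have hC : Subsingleton C := Module.FaithfullyFlat.lTensor_reflects_triviality A₁ B₁ C
    have hrange : LinearMap.range θ = ⊤ := Submodule.Quotient.subsingleton_iff.mp hC
    intro r
    obtain ⟨a, ha⟩ : r ∈ LinearMap.range θ := hrange ▸ Submodule.mem_top
    exact ⟨a, ha⟩
  -- Step 2: the kernel `𝔞` and `R = A₁/𝔞`
  let 𝔞 : Ideal A₁ := RingHom.ker (algebraMap A₁ R)
  let eR : (A₁ ⧸ 𝔞) ≃ₐ[A₁] R :=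
    Ideal.quotientKerAlgEquivOfSurjective (f := Algebra.ofId A₁ R) hθsurj
  -- Step 3: `𝔞B₁ = Ker(B₁ → B₁ ⊗ R)` is finitely generated
  let ι : B₁ →ₐ[Λ] B₁ ⊗[A₁] R := Algebra.TensorProduct.includeLeft
  have hι : Function.Surjective ι := fun z => by
    obtain ⟨b, hb⟩ := hsurj z
    exact ⟨b, hb⟩
  haveI : Algebra.FinitePresentation Λ B₁ := Algebra.FinitePresentation.trans Λ A₁ B₁
  have hKfg : (RingHom.ker ι.toRingHom).FG := Algebra.FinitePresentation.ker_fG_of_surjective ι hι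
  have hK : RingHom.ker ι.toRingHom = 𝔞.map (algebraMap A₁ B₁) := by
    let φ : B₁ ⊗[A₁] R ≃ₐ[A₁] B₁ ⊗[A₁] (A₁ ⧸ 𝔞) :=
      Algebra.TensorProduct.congr (AlgEquiv.refl : B₁ ≃ₐ[A₁] B₁) eR.symm
    let e𝔞 := Algebra.TensorProduct.quotIdealMapEquivTensorQuot B₁ 𝔞
    ext b
    have hφ : φ (ι b) = b ⊗ₜ[A₁] (1 : A₁ ⧸ 𝔞) := by
      change φ (b ⊗ₜ[A₁] (1 : R)) = _
      rw [Algebra.TensorProduct.congr_apply, Algebra.TensorProduct.map_tmul, map_one]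
      rfl
    rw [RingHom.mem_ker]
    change ι b = 0 ↔ b ∈ 𝔞.map (algebraMap A₁ B₁)
    rw [← map_eq_zero_iff φ φ.injective, hφ, ← Algebra.TensorProduct.quotIdealMapEquivTensorQuot_mk,
      map_eq_zero_iff e𝔞 e𝔞.injective, Ideal.Quotient.eq_zero_iff_mem]
  rw [hK] at hKfg
  -- Step 4/5: `𝔞` is finitely generated
  obtain ⟨𝔞', h𝔞'fg, h𝔞'le, h𝔞'map⟩ := 𝔞.exists_fg_le_map_eq hKfg
  have h𝔞eq : 𝔞 = 𝔞' := by
    refine le_antisymm ?_ h𝔞'le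
    rw [← Ideal.comap_map_eq_self_of_faithfullyFlat (B := B₁) 𝔞,
      ← Ideal.comap_map_eq_self_of_faithfullyFlat (B := B₁) 𝔞', h𝔞'map]
  have h𝔞fg : 𝔞.FG := h𝔞eq ▸ h𝔞'fg
  -- Step 6: `R ≅ A₁/𝔞` is of finite presentation over `Λ`
  haveI : Algebra.FinitePresentation Λ (A₁ ⧸ RingHom.ker (IsScalarTower.toAlgHom Λ A₁ R)) :=
    Algebra.FinitePresentation.quotient h𝔞fg
  exact Algebra.FinitePresentation.equiv
    (Ideal.quotientKerAlgEquivOfSurjective (f := IsScalarTower.toAlgHom Λ A₁ R) hθsurj)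

end Literature.RingTheory.Flat
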